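import Mathlib
import Summits.Ventures.DiscreteObjects.Mahler.CyclotomicIntegerLehmer
import Summits.Ventures.DiscreteObjects.Mahler.SmythIsolationEquality

/-!
# Lehmer's conjecture for cyclotomic integers of every conductor `m < 3·5·7·…·31` (venture `DiscreteObjects`, target L)

Cell `pub-namedobj`, seat `pub-namedobj-mahler-g27`. Framing: lottery ticket; floor = certified bounds/negative ranges.

Bookkeeping corollary of `CyclotomicIntegerLehmer.lehmer_of_cyclotomicInteger` ([cite: BombieriGubler2001, Theorem 4.4.9,
Case I] for the odd primes `p ≤ 31`, for which `1.17629^{p+1} < (p/2)²`): if some odd prime `p ≤ 31` does not divide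
`m`, every cyclotomic integer `α = g(ζ_m) ≠ 0` which is not a root of unity has `M(α) > M(ℓ)`; all ten odd primes `≤ 31`
divide `m` only if their product `100 280 245 065` does.  Hence **for every `m < 100 280 245 065`, no cyclotomic integer
`g(ζ_m)` of `ℚ(ζ_m)` is a sub-Lehmer number** (`lehmer_of_cyclotomicInteger_of_lt`).  Our formulation; no new mathematics.
-/

namespace Summit.Ventures.DiscreteObjects.Mahler

open Polynomial Finset

/-- If every odd prime `p ≤ 31` divides `m ≠ 0`, then `3·5·7·11·13·17·19·23·29·31 = 100280245065 ≤ m`. -/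
theorem oddPrimorial_thirtyone_le {m : ℕ} (hm : 0 < m) (h : ∀ p : ℕ, p.Prime → p ≤ 31 → p ≠ 2 → p ∣ m) :
    100280245065 ≤ m := by
  have hdvd : (100280245065 : ℕ) ∣ m := by
    have e : (100280245065 : ℕ) = 3 * 5 * 7 * 11 * 13 * 17 * 19 * 23 * 29 * 31 := by norm_num
    rw [e]
    have h3 := h 3 Nat.prime_three (by norm_num) (by norm_num)
    have h5 := h 5 Nat.prime_five (by norm_num) (by norm_num)
    have h7 := h 7 (by norm_num) (by norm_num) (by norm_num)
    have h11 := h 11 (by norm_num) (by norm_num) (by norm_num)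
    have h13 := h 13 (by norm_num) (by norm_num) (by norm_num)
    have h17 := h 17 (by norm_num) (by norm_num) (by norm_num)
    have h19 := h 19 (by norm_num) (by norm_num) (by norm_num)
    have h23 := h 23 (by norm_num) (by norm_num) (by norm_num)
    have h29 := h 29 (by norm_num) (by norm_num) (by norm_num)
    have h31 := h 31 (by norm_num) (by norm_num) (by norm_num)
    repeat' apply Nat.Coprime.mul_dvd_of_dvd_of_dvd (by norm_num)
    all_goals assumption
  exact Nat.le_of_dvd hm hdvd

/-- **Lehmer's conjecture for the cyclotomic integers of `ℚ(ζ_m)`, every `m < 100 280 245 065 = 3·5·⋯·31`.**  For such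
`m`, a primitive `m`-th root of unity `ζ ∈ ℂ` and `g ∈ ℤ[X]` with `α = g(ζ) ≠ 0` not a root of unity: `M(α) > M(ℓ)`,
Lehmer's number. -/
theorem lehmer_of_cyclotomicInteger_of_lt {m : ℕ} (hm : 0 < m) (hlt : m < 100280245065) (g : ℤ[X]) {ζ : ℂ}
    (hζ : IsPrimitiveRoot ζ m) (h0 : aeval ζ g ≠ 0) (hnu : ∀ k : ℕ, 0 < k → aeval ζ g ^ k ≠ 1) :
    intMahlerMeasure lehmerPoly < intMahlerMeasure (minpoly ℤ (aeval ζ g)) := by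
  by_contra hcon
  have hall : ∀ p : ℕ, p.Prime → p ≤ 31 → p ≠ 2 → p ∣ m := by
    intro p hp hp31 hp2
    by_contra hndvd
    have hcop : p.Coprime m := (Nat.Prime.coprime_iff_not_dvd hp).2 hndvd
    have h3p : 3 ≤ p := by
      rcases hp.eq_two_or_odd' with h | h
      · exact absurd h hp2
      · have := hp.two_le; omega
    -- the numerical condition `1.17629^{p+1} < (p/2)²` for `3 ≤ p ≤ 31`
    have hnum : ((117629 : ℝ) / 100000) ^ (p + 1) < ((p : ℝ) / 2) ^ 2 := by
      interval_cases p <;> norm_num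
    exact hcon (lehmer_of_cyclotomicInteger hm hp hcop hnum g hζ h0 hnu)
  exact absurd (oddPrimorial_thirtyone_le hm hall) (by omega)

/-- **Census reading** (cell vocabulary `SubLehmer P : 1 < M(P) < M(ℓ)`): every complex root of a sub-Lehmer integer
polynomial which is a cyclotomic integer `g(ζ_m)`, `m < 100 280 245 065`, is `0` or a root of unity — i.e. the
non-cyclotomic part of a sub-Lehmer polynomial has NO root in `ℤ[ζ_m]` for these `m`. -/
theorem subLehmer_root_cyclotomicInteger_torsion {P : ℤ[X]} (hP : SubLehmer P) {m : ℕ} (hm : 0 < m)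
    (hlt : m < 100280245065) {ζ : ℂ} (hζ : IsPrimitiveRoot ζ m) (g : ℤ[X]) (hroot : aeval (aeval ζ g) P = 0) :
    aeval ζ g = 0 ∨ ∃ k : ℕ, 0 < k ∧ aeval ζ g ^ k = 1 := by
  by_contra hcon
  push Not at hcon
  obtain ⟨h0, hnu⟩ := hcon
  have hζint : IsIntegral ℤ ζ := hζ.isIntegral hm
  have hαint : IsIntegral ℤ (aeval ζ g) := by
    have hmem : aeval ζ g ∈ Algebra.adjoin ℤ {ζ} := Polynomial.aeval_mem_adjoin_singleton ℤ ζ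
    exact (mem_integralClosure_iff ℤ ℂ).1 (adjoin_le_integralClosure hζint hmem)
  have hdvd : minpoly ℤ (aeval ζ g) ∣ P := minpoly.isIntegrallyClosed_dvd hαint hroot
  have hP0 : P ≠ 0 := by
    intro h
    have h1 := hP.1
    rw [h] at h1
    unfold intMahlerMeasure at h1
    rw [Polynomial.map_zero, mahlerMeasure_zero] at h1
    linarith
  have h1 := intMahlerMeasure_le_of_dvd hP0 hdvd
  have h2 := lehmer_of_cyclotomicInteger_of_lt hm hlt g hζ h0 hnu
  have h3 := hP.2
  linarith

end Summit.Ventures.DiscreteObjects.Mahler
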